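import Summits.BirchSwinnertonDyer.BirchSwinnertonDyer.Theorems.ByReductionTypeAtTwoSupersingularFlatColemanLinearOfTraces
import Literature.NumberTheory.EllipticCurves.Sprung2024.ChromaticSmallControlSurjProofs
import HarnessLib

/-!
# Route `ByReductionTypeAtTwo` (rung K4), crux `SupersingularRankZeroAtTwo` (item stmt-BirchSwinnertonDyer-19097), line
# `odd_blind_package` (v2.13: stub `stub_flatKernelCyclic`), sub-hand h13a(iii) of `HAND-TARGETS-NF-1.md`: **a non-zero ♭ Coleman value
# from ONE tower functional that does not vanish at `c₀`** (level `0` of the Coleman condition: `L♭(0) = −z(c₀)`), hence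
# **`Ker Col♭ = Λ ∙ z♭` modulo «`H¹_Iw ≅ Λ²`» and «some `z` with `z(c₀) ≠ 0`»** (cell `bsd-2adic`, LEAD ss-1 GEN 23; `--supports 19097`, helper)

HONEST FRAMING: THEOREMS ONLY (no definition, no named fact, no `sorry`, no instance); generic in the base field, the `ℤ_p`-extension,
the place and `p` (so valid at `p = 2`, no Honda-legality clause).  Nothing about any curve is computed; 19097 OPEN; BSD is proved for no curve.

* `constantCoeff_flat_eq_neg_apply_of_isColemanPair` — level `0` of `IsColemanPair`: `ω₀ = T`, `(u₀, v₀) = (0, 1)`, `P_{0,c₀}(z) = z(c₀)`, so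
  `L♭(0) = −z(c₀)` (the tree's `IsColemanPair.constantCoeff_flat` states this for a Sprung Honda system with `c₀ = (a_p − 2)c₋₁`; here for
  the bare datum `c`, as the registry quantifies it);
* `flat_ne_zero_of_isColemanPair_of_apply_ne_zero` — `z(c₀) ≠ 0 ⟹ L♭ ≠ 0`;
* ★ `exists_colemanKer_flat_eq_span_of_linearEquiv_fin_two_of_apply_ne_zero` — h13a in kernel form with input (iii) replaced by the
  elementary «some tower functional `z` has `z(c₀) ≠ 0`» (for a Honda system at two: any `z` with `2 ∤ z(c₋₁)`, since `c₀ = (a²−2a−1)c₋₁` with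
  `a²−2a−1` odd for `a ∈ {0, ±2}`): then `Ker Col♭ = Λ ∙ z♭` GIVEN `e : H¹_Iw(T) ≃ₗ[Λ] Λ²` (Greenberg 1989 §3 Cor. 2, displayed), by ★ p823375
  `exists_colemanKer_flat_eq_span_of_linearEquiv_fin_two`.

References: [Sprung2012] Def. 5.9 (p. 1495), Def. 7.2 (p. 1500: `Col♭_0 = −P¹_0`), Def. 7.9; [Sprung2017] §4 (`v₀ = 1`, `u₀ = 0`);
[KitajimaOtsuki2018] Prop. 3.29, 3.32.
-/

set_option autoImplicit false
-- the Theorems namespace of this sub repeats the summit name by design (D-0017 nested layout)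
set_option linter.dupNamespace false

noncomputable section

open scoped Classical NumberField

open NumberField IsDedekindDomain Polynomial WeierstrassCurve Literature.NumberTheory.EllipticCurves
  Literature.NumberTheory.EllipticCurves.ZpExtension Literature.NumberTheory.EllipticCurves.Sprung2017
  Literature.NumberTheory.EllipticCurves.Kobayashi2003 Literature.NumberTheory.EllipticCurves.Sprung2012
  Literature.NumberTheory.GaloisRepresentations

universe u

namespace Summit.BirchSwinnertonDyer.BirchSwinnertonDyer.Theorems

namespace OddBlindNF

variable {K : Type u} [Field K] {p : ℕ} [Fact p.Prime] {κ : ZpExtension K p}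
variable {E : Type u} [Field E] [Algebra K E] {ι : AlgebraicClosure K →ₐ[K] AlgebraicClosure E}
variable {W : WeierstrassCurve K}

/-- **Level `0` of the Coleman condition: `L♭(0) = −z(c₀)`.**  In the transcription `IsColemanPair`, level `0` reads
`ω₀ = T ∣ P_{0,c₀}(z) + u₀·L♯ + v₀·L♭` with `(u₀, v₀) = (0, 1)` and `P_{0,c₀}(z) = z(c₀)`; constant terms give the claim.
[cite: Sprung2012, Def. 7.2 (p. 1500) and Def. 5.9 (p. 1495)] -/
theorem constantCoeff_flat_eq_neg_apply_of_isColemanPair {ap : ℤ} {g : Field.absoluteGaloisGroup E} {c : ℕ → localPoints W E}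
    (hc0 : c 0 ∈ localTowerPointsOfEmb κ ι W)
    {z : localTowerPointsOfEmb κ ι W →+ ℤ_[p]} {Lsharp Lflat : IwasawaAlgebra p}
    (hz : IsColemanPair κ ι W ap g c z Lsharp Lflat) :
    PowerSeries.constantCoeff Lflat = -(z ⟨c 0, hc0⟩) := by
  have h0 := constantCoeff_eq_zero_of_toIwasawa_cyclotomicOmega_dvd (hz 0)
  rw [map_add, map_add, map_mul, map_mul, sharpPoly_zero, flatPoly_zero, map_zero, map_one, map_zero, zero_mul,
    map_one, one_mul, zero_add, constantCoeff_pairingSum, pow_zero, Finset.sum_range_one, pow_zero, one_smul,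
    evalOn_of_mem W _ z hc0] at h0
  linear_combination h0

/-- **`z(c₀) ≠ 0 ⟹ L♭ ≠ 0`** for any Coleman value `(L♯, L♭)` of `z`. [cite: Sprung2012, Def. 7.2 (p. 1500)] -/
theorem flat_ne_zero_of_isColemanPair_of_apply_ne_zero {ap : ℤ} {g : Field.absoluteGaloisGroup E} {c : ℕ → localPoints W E}
    (hc0 : c 0 ∈ localTowerPointsOfEmb κ ι W)
    {z : localTowerPointsOfEmb κ ι W →+ ℤ_[p]} {Lsharp Lflat : IwasawaAlgebra p}
    (hz : IsColemanPair κ ι W ap g c z Lsharp Lflat) (hne : z ⟨c 0, hc0⟩ ≠ 0) : Lflat ≠ 0 := by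
  intro h0
  apply hne
  have h := constantCoeff_flat_eq_neg_apply_of_isColemanPair hc0 hz
  rw [h0, map_zero] at h
  exact neg_eq_zero.mp h.symm

/-- ★ **h13a in kernel form, elementary input (iii)**: for every datum `(g, c)` of the registry (levels `hc`, traces `htr`, `p ∣ a_p`, local lift
`g`), GIVEN `e : H¹_Iw(T) ≃ₗ[Λ] Λ²` (Greenberg 1989 §3 Cor. 2 in the functional model — displayed) and ONE tower functional `z` with `z(c₀) ≠ 0`
(displayed; for Honda-legal data any `z` with `p ∤ z(c₋₁)`), `Ker Col♭ = Λ ∙ z♭` for some `z♭`.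
[cite: KitajimaOtsuki2018, Prop. 3.29 and Prop. 3.32 (arXiv:1607.03612 p. 16)] [cite: Sprung2012, Def. 7.2, Def. 7.9] -/
theorem exists_colemanKer_flat_eq_span_of_linearEquiv_fin_two_of_apply_ne_zero {g : Field.absoluteGaloisGroup E}
    (hg : κ.IsTopGenerator (resGalOfEmb ι g)) {ap : ℤ} (hap : (p : ℤ) ∣ ap) {c : ℕ → localPoints W E}
    (hcn : ∀ k, c k ∈ localLayerPointsOfEmb κ ι W k)
    (htr : ∀ n, 1 ≤ n → localTraceOfEmb κ ι W n (n + 1) (c (n + 1)) = ap • c n - c (n - 1))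
    (e : letI := moduleOfGenerator κ ι W hg
      (localTowerPointsOfEmb κ ι W →+ ℤ_[p]) ≃ₗ[IwasawaAlgebra p] (Fin 2 → IwasawaAlgebra p))
    (hz : ∃ z : localTowerPointsOfEmb κ ι W →+ ℤ_[p],
      z ⟨c 0, localLayerPointsOfEmb_le_localTowerPointsOfEmb κ ι W 0 (hcn 0)⟩ ≠ 0) :
    letI := moduleOfGenerator κ ι W hg
    ∃ zf : localTowerPointsOfEmb κ ι W →+ ℤ_[p],
      colemanKer κ ι W ap g c .flat = (Submodule.span (IwasawaAlgebra p) {zf} : Set _) := by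
  obtain ⟨z, hzne⟩ := hz
  obtain ⟨Ls, Lf, hCP⟩ := exists_isColemanPair_of_traces hg hap hcn htr z
  exact exists_colemanKer_flat_eq_span_of_linearEquiv_fin_two hg hap hcn htr e
    ⟨z, Ls, Lf, hCP, flat_ne_zero_of_isColemanPair_of_apply_ne_zero _ hCP hzne⟩

end OddBlindNF

end Summit.BirchSwinnertonDyer.BirchSwinnertonDyer.Theorems

end
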